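import Literature.AlgebraicTopology.SingularHomology.CohomologySelfMapFixingOpenSet
import Literature.AlgebraicTopology.SingularHomology.CohomologyMayerVietorisExtend
import HarnessLib

/-!
# Localisation of a self-map fixing an open set: the vanishing space IS the local cohomology when the overlap is
# acyclic in two degrees (Mayer–Vietoris, Hatcher §3.1)

Layer `Literature/AlgebraicTopology/SingularHomology`; theorems only. Sequel of `CohomologySelfMapFixingOpenSet`
(prover seat `hodge-nonav-prover-Ax`, g9; programme "localisation of the nodal meridian monodromy" of the route
`Summits/HodgeConjecture/HodgeConjecture/Theses/CyclicUnitaryPowers.lean`, crux K1).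

For an open cover `X = A ∪ B`, `V := ker (H^{q+1}(X; R) → H^{q+1}(B; R))`:
* `CohomologySelfMapFixingOpenSet.localisation_of_selfMap_eqOn` used `H^q(A ∩ B) = 0` to make `res_A : V → H^{q+1}(A)`
  INJECTIVE (`dim V ≤ dim H^{q+1}(A)` — the bound form of the cited nodal-meridian fact);
* here, with ALSO `H^{q+1}(A ∩ B) = 0`, `res_A : V → H^{q+1}(A)` is SURJECTIVE (every class on `A` extends to `X` by
  zero on `B`, `exists_map_subsetIncl_eq_of_isZero`), so `dim V = dim H^{q+1}(A)`
  (`finrank_ker_eq_of_isZero_isZero`) — the EQUALITY form `dim V = μ` of the cited fact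
  `HodgeTheory.carlsonToledo1999_nodalMeridianLocalMonodromy`, for a Milnor-ball piece `A` whose collar `A ∩ B`
  (≃ link × interval) is rationally acyclic in degrees `q, q+1` (the link of `A_{p−1}` is a lens space, a
  `ℚ`-homology sphere).

## References

* [HatcherAT2002] A. Hatcher, Algebraic Topology, CUP 2002, §3.1 pp. 203–204 (Mayer–Vietoris in cohomology).
-/

noncomputable section

open CategoryTheory Limits Set

universe u

namespace Literature.AlgebraicTopology.SingularHomology

namespace singularCohomology

variable (R : Type u) [CommRing R] {X : Type u} [TopologicalSpace X]

/-- **`res_A : ker res_B → H^{q+1}(A)` is surjective when `H^{q+1}(A ∩ B) = 0`** (extension by zero across an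
acyclic overlap). [cite: HatcherAT2002, §3.1 pp. 203–204] -/
theorem map_subsetIncl_surjOn_ker_of_isZero {A B : Set X} (hAo : IsOpen A) (hBo : IsOpen B)
    (hAB : A ∪ B = univ) {n : ℕ} (hZ : IsZero (singularCohomology R R (↥(A ∩ B)) n))
    (y : singularCohomology R R (↥A) n) :
    ∃ v ∈ LinearMap.ker (map R R (subsetIncl B) n).hom, map R R (subsetIncl A) n v = y := by
  obtain ⟨c, hcA, hcB⟩ := exists_map_subsetIncl_eq_of_isZero R hAo hBo hAB hZ y
  exact ⟨c, LinearMap.mem_ker.mpr hcB, hcA⟩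

/-- **`dim ker res_B = dim H^{q+1}(A)` when `H^q(A ∩ B) = H^{q+1}(A ∩ B) = 0`**: `res_A` restricted to
`V = ker res_B` is injective (Mayer–Vietoris at `H^{q+1}(X)`, `eq_zero_of_map_subsetIncl_eq_zero`) and surjective
(extension by zero, `exists_map_subsetIncl_eq_of_isZero`). With `CohomologySelfMapFixingOpenSet`: for a self-map
`h` fixing `B` pointwise and preserving `A`, `(h^* − 1)H^{q+1}(X) ⊆ V ≅ H^{q+1}(A)` equivariantly.
[cite: HatcherAT2002, §3.1 pp. 203–204] -/
theorem finrank_ker_eq_of_isZero_isZero [Nontrivial R] {A B : Set X} (hAo : IsOpen A) (hBo : IsOpen B)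
    (hAB : A ∪ B = univ) {q : ℕ} (hZ : IsZero (singularCohomology R R (↥(A ∩ B)) q))
    (hZ' : IsZero (singularCohomology R R (↥(A ∩ B)) (q + 1)))
    [Module.Finite R (singularCohomology R R (↥A) (q + 1))] :
    Module.finrank R ↥(LinearMap.ker (map R R (subsetIncl B) (q + 1)).hom) =
      Module.finrank R (singularCohomology R R (↥A) (q + 1)) := by
  let φ : ↥(LinearMap.ker (map R R (subsetIncl B) (q + 1)).hom) →ₗ[R] singularCohomology R R (↥A) (q + 1) :=
    (map R R (subsetIncl A) (q + 1)).hom.comp (Submodule.subtype _)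
  have hker : ∀ v : singularCohomology R R X (q + 1),
      v ∈ LinearMap.ker (map R R (subsetIncl B) (q + 1)).hom ↔ map R R (subsetIncl B) (q + 1) v = 0 :=
    fun v => LinearMap.mem_ker
  have hinj : Function.Injective φ := by
    intro v w hvw
    apply Subtype.ext
    have h0 : (v : singularCohomology R R X (q + 1)) - w = 0 := by
      refine eq_zero_of_map_subsetIncl_eq_zero R hAo hBo hAB hZ _ ?_ ?_
      · rw [map_sub, sub_eq_zero]
        exact hvw
      · rw [map_sub, (hker _).1 v.2, (hker _).1 w.2, sub_zero]
    exact sub_eq_zero.1 h0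
  have hsurj : Function.Surjective φ := by
    intro y
    obtain ⟨v, hv, hvy⟩ := map_subsetIncl_surjOn_ker_of_isZero R hAo hBo hAB hZ' y
    exact ⟨⟨v, hv⟩, hvy⟩
  exact (LinearEquiv.ofBijective φ ⟨hinj, hsurj⟩).finrank_eq

end singularCohomology

end Literature.AlgebraicTopology.SingularHomology

end
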